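/-
Origin: expansion seat `planner-pub-hodgecm-prl1-g2-0`, handover #1 2026-08-18 (`HOME/pub-hodgecm-prl1-g2/lean/Prl1g2/CorCMLeaves.lean`, md5 2ff20d26, 176 lines);
landed by the gen-6 packager in gate run 22 as `HodgeCM/Assembly/CorCMLeaves.lean` (verbatim).
-/
/-
Origin: HOME/pub-hodgecm-prl1-g2/lean/Prl1g2/CorCMLeaves.lean — session planner-pub-hodgecm-prl1-g2-0
(unit pub-hodgecm-prl1-g2, EXPANSION PROVER a-1 gen 2 on `RealisationExistsPerL` / `RealisationExistsFace`).
Intended final place (packager's call): `HodgeCM/Assembly/CorCMLeaves.lean`; module rename `Prl1g2.` ↦ `HodgeCM.Assembly.`.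
Imports: LANDED modules only (run 21 tree): `HodgeCM.PerL34.AssemblyLeaves` (carver-g2 v2, run 21) and
`HodgeCM.Assembly.CorCMEndState` (landherr-g2, run 19).  NEW, ADDITIVE; touches no existing file.

KIND: KERNEL glue (L5 assembly).  NOTHING is cited or posited here: every declaration is a one-line composition of
audited theorems of the certified tree.

# The ten-field record `T.Inputs` — and hence BOTH realisation inputs of `U.OpenInputs` and the COR-CM end state —
# from the carver's LEAVES (LEMMAS.md v6 §§8–9), with no `A : T.Inputs` binder left

The carver's leaf assemblies `HodgeCM.PerL34.perL_of_leaves` / `perL_of_leaves'` (`AssemblyLeaves.lean`) conclude `U.PerL`.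
The cell's HEADLINE is `U.HC_CM` (`Assembly.COR_CM_endState (M) (h29) (h30) (hE) (hD) (hMi) (T) (A : T.Inputs) (hHR)`),
and the two OPEN INPUTS this seat owns are `U.RealisationExistsPerL` / `U.RealisationExistsFace`
(`StubTree/Inputs.lean`), proved by gen 1 from `(M) (A : T.Inputs) (hHR)` (`ThetaModel.realisationExists_of''`,
`Proofs/SeesawConstruction.lean`).  This file factors the carver's leaf wiring through the record:

* `inputs_of_leaves`  : the binders of `perL_of_leaves` minus `M`/`h07`  ⟹  `T.Inputs`
  (`axioms_of_nodes` with h29 := `N29_occ_of_archC`, h31 := `N31_chars_of_cluster`, h33 := `N33_wedge_of_printSteps`);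
* `inputs_of_leaves'` : the binders of `perL_of_leaves'` minus `M`/`h07` ⟹  `T.Inputs`
  (additionally h19w := `N19w_wedgeMem_of_genIdentity`, h19g := `N19g_genInWedgeSpan_of_core`);
* `realisationExists_of_leaves'` : `U.RealisationExistsPerL ∧ U.RealisationExistsFace` from `M`, the leaves and `h07`;
* `openInputs_of_leaves'` : the whole record `U.OpenInputs` from the same plus `(hP : U.PohlmannSpan) (hQ : U.Qw8Sufficiency)`;
* `COR_CM_of_leaves'` : `U.HC_CM` from `M`, the leaves, `h07`, `hP`, `hQ` (`Assembly.COR_CM_theta''`);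
* `COR_CM_endState_of_leaves'` : the END STATE `Assembly.COR_CM_endState` with its binder `A : T.Inputs` REPLACED by the
  leaves — remaining hypotheses: `M : U.ModelAxioms`, M29/M30 (`h29 h30`), the three [QW8]-side inputs (`hE hD hMi`),
  PRINT leaves `h07 h09a h09b`, DESIGN `h12b`, `h12a : N12a_thetaSub T` (= `T.Open_thetaSub`, seam S6), the model-level
  leaves `hgen` / `hcore` (seam S5), archimedean Lemma-4.1(c) data `Pc A12 A34` (seam S4), `h31 : ClusterOutputs T` (S3),
  `h33 : WedgeToClasses.StepsPrintInput T` (S1/S2).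

So after this file the record `A : T.Inputs` is no longer a hypothesis of any end-state theorem: each of its ten fields is
fed BY NAME (2 PRINT + 2 DESIGN verbatim, 6 PerL open inputs through the landed node feeders).  The successor file
`CorCMPrintLeaves.lean` (run-22 names: carver-g2 `AssemblyDict`/`AssemblyPrint`, pv04-g2 `ThetaSubOfLiu`, pv02-g2
`QautDictionary`/`CharSpans`, pv11 `SeesawDictionary`) does the same one level further down (S5/S6 by name).
PROVED; closure = the standard trio (all ingredients are audited run-19/21 theorems).
-/
import Summits.HodgeConjecture.HodgeCM.PerL34.AssemblyLeaves
import Summits.HodgeConjecture.HodgeCM.Assembly.CorCMEndState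

/-! PORT of `HodgeCM/Assembly/CorCMLeaves.lean` (HodgeCMPerL run 82) — verbatim mechanical port; provenance in the PORT header line. -/

set_option autoImplicit false

noncomputable section

namespace HodgeCM
namespace PerL34

open HodgeCM.Prior.Perl34File HodgeCM.Prior.Perl34File.Perl34 HodgeCM.PerL34.ArchC

variable {U : Universe}

/-- **`T.Inputs` from the leaves (v1)**: `axioms_of_nodes` with N29, N31, N33 fed BY NAME from the landed feeders
(`N29_occ_of_archC`, `N31_chars_of_cluster`, `N33_wedge_of_printSteps`).  Binders = those of `perL_of_leaves` minus
`M` and `h07`. -/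
theorem inputs_of_leaves (T : U.ThetaModel) (h09a : N09a_embCover T) (h09b : N09b_innerEmb T)
    (h12a : N12a_thetaSub T) (h12b : N12b_signRecipe T)
    (h19w : N19w_wedgeMem T) (h19g : N19g_genInWedgeSpan T)
    (Pc : ∀ {L : CMField} {ι₁ : L →+* ℂ} (V : HermSpace3 L ι₁) (c : SeesawCtx L),
      C4a.PointedCore (T.core V c))
    (A12 : ∀ {L : CMField} {ι₁ : L →+* ℂ} (V : HermSpace3 L ι₁) (c : SeesawCtx L),
      T.GoodCtx ι₁ c → Nonempty (ArchCDatum (T.core V c) (T.t12 V c) (Pc V c)))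
    (A34 : ∀ {L : CMField} {ι₁ : L →+* ℂ} (V : HermSpace3 L ι₁) (c : SeesawCtx L),
      T.GoodCtx ι₁ c → Nonempty (ArchCDatum (T.core V c) (T.t34 V c) (Pc V c)))
    (h31 : ClusterOutputs T) (h33 : WedgeToClasses.StepsPrintInput T) : T.Inputs :=
  axioms_of_nodes T h09a h09b h12a h12b h19w h19g (N29_occ_of_archC T Pc A12 A34) (N31_chars_of_cluster T h31)
    (N33_wedge_of_printSteps T h33)

/-- **`T.Inputs` from the leaves (v2)**: additionally N19w / N19g fed BY NAME from the model-level leaves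
(`N19w_wedgeMem_of_genIdentity`, `N19g_genInWedgeSpan_of_core`).  Binders = those of `perL_of_leaves'` minus `M`
and `h07`. -/
theorem inputs_of_leaves' (T : U.ThetaModel) (h09a : N09a_embCover T) (h09b : N09b_innerEmb T)
    (h12a : N12a_thetaSub T) (h12b : N12b_signRecipe T)
    (hgen : ∀ {L : CMField} {ι₁ : L →+* ℂ} (V : HermSpace3 L ι₁) (c : SeesawCtx L), T.GoodCtx ι₁ c →
      N19w_genIdentity T V c (T.t12 V c) 0 1)
    (hcore : ∀ {L : CMField} {ι₁ : L →+* ℂ} (V : HermSpace3 L ι₁) (c : SeesawCtx L), T.GoodCtx ι₁ c →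
      N19g_core T V c (T.t34 V c) 2 3)
    (Pc : ∀ {L : CMField} {ι₁ : L →+* ℂ} (V : HermSpace3 L ι₁) (c : SeesawCtx L),
      C4a.PointedCore (T.core V c))
    (A12 : ∀ {L : CMField} {ι₁ : L →+* ℂ} (V : HermSpace3 L ι₁) (c : SeesawCtx L),
      T.GoodCtx ι₁ c → Nonempty (ArchCDatum (T.core V c) (T.t12 V c) (Pc V c)))
    (A34 : ∀ {L : CMField} {ι₁ : L →+* ℂ} (V : HermSpace3 L ι₁) (c : SeesawCtx L),
      T.GoodCtx ι₁ c → Nonempty (ArchCDatum (T.core V c) (T.t34 V c) (Pc V c)))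
    (h31 : ClusterOutputs T) (h33 : WedgeToClasses.StepsPrintInput T) : T.Inputs :=
  inputs_of_leaves T h09a h09b h12a h12b (N19w_wedgeMem_of_genIdentity T hgen h31)
    (N19g_genInWedgeSpan_of_core T hcore) Pc A12 A34 h31 h33

/-- **Both realisation inputs of `U.OpenInputs` from the leaves** (`ThetaModel.realisationExists_of''` over
`inputs_of_leaves'`).  This is the prl1 target pair `RealisationExistsPerL ∧ RealisationExistsFace` with no
`A : T.Inputs` binder. -/
theorem realisationExists_of_leaves' (M : U.ModelAxioms) (T : U.ThetaModel)
    (h07 : N07_hodgeRiemann20 U) (h09a : N09a_embCover T) (h09b : N09b_innerEmb T)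
    (h12a : N12a_thetaSub T) (h12b : N12b_signRecipe T)
    (hgen : ∀ {L : CMField} {ι₁ : L →+* ℂ} (V : HermSpace3 L ι₁) (c : SeesawCtx L), T.GoodCtx ι₁ c →
      N19w_genIdentity T V c (T.t12 V c) 0 1)
    (hcore : ∀ {L : CMField} {ι₁ : L →+* ℂ} (V : HermSpace3 L ι₁) (c : SeesawCtx L), T.GoodCtx ι₁ c →
      N19g_core T V c (T.t34 V c) 2 3)
    (Pc : ∀ {L : CMField} {ι₁ : L →+* ℂ} (V : HermSpace3 L ι₁) (c : SeesawCtx L),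
      C4a.PointedCore (T.core V c))
    (A12 : ∀ {L : CMField} {ι₁ : L →+* ℂ} (V : HermSpace3 L ι₁) (c : SeesawCtx L),
      T.GoodCtx ι₁ c → Nonempty (ArchCDatum (T.core V c) (T.t12 V c) (Pc V c)))
    (A34 : ∀ {L : CMField} {ι₁ : L →+* ℂ} (V : HermSpace3 L ι₁) (c : SeesawCtx L),
      T.GoodCtx ι₁ c → Nonempty (ArchCDatum (T.core V c) (T.t34 V c) (Pc V c)))
    (h31 : ClusterOutputs T) (h33 : WedgeToClasses.StepsPrintInput T) :
    U.RealisationExistsPerL ∧ U.RealisationExistsFace :=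
  T.realisationExists_of'' M (inputs_of_leaves' T h09a h09b h12a h12b hgen hcore Pc A12 A34 h31 h33) h07

/-- **The record `U.OpenInputs` from the leaves** plus the two non-PerL inputs `PohlmannSpan` / `Qw8Sufficiency`. -/
theorem openInputs_of_leaves' (M : U.ModelAxioms) (T : U.ThetaModel)
    (h07 : N07_hodgeRiemann20 U) (h09a : N09a_embCover T) (h09b : N09b_innerEmb T)
    (h12a : N12a_thetaSub T) (h12b : N12b_signRecipe T)
    (hgen : ∀ {L : CMField} {ι₁ : L →+* ℂ} (V : HermSpace3 L ι₁) (c : SeesawCtx L), T.GoodCtx ι₁ c →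
      N19w_genIdentity T V c (T.t12 V c) 0 1)
    (hcore : ∀ {L : CMField} {ι₁ : L →+* ℂ} (V : HermSpace3 L ι₁) (c : SeesawCtx L), T.GoodCtx ι₁ c →
      N19g_core T V c (T.t34 V c) 2 3)
    (Pc : ∀ {L : CMField} {ι₁ : L →+* ℂ} (V : HermSpace3 L ι₁) (c : SeesawCtx L),
      C4a.PointedCore (T.core V c))
    (A12 : ∀ {L : CMField} {ι₁ : L →+* ℂ} (V : HermSpace3 L ι₁) (c : SeesawCtx L),
      T.GoodCtx ι₁ c → Nonempty (ArchCDatum (T.core V c) (T.t12 V c) (Pc V c)))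
    (A34 : ∀ {L : CMField} {ι₁ : L →+* ℂ} (V : HermSpace3 L ι₁) (c : SeesawCtx L),
      T.GoodCtx ι₁ c → Nonempty (ArchCDatum (T.core V c) (T.t34 V c) (Pc V c)))
    (h31 : ClusterOutputs T) (h33 : WedgeToClasses.StepsPrintInput T)
    (hP : U.PohlmannSpan) (hQ : U.Qw8Sufficiency) : U.OpenInputs :=
  let hR := realisationExists_of_leaves' M T h07 h09a h09b h12a h12b hgen hcore Pc A12 A34 h31 h33
  { realisation_perL := hR.1, realisation_face := hR.2, pohlmann_span := hP, qw8_sufficiency := hQ }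

end PerL34

namespace Assembly

open HodgeCM.Prior.Perl34File HodgeCM.Prior.Perl34File.Perl34 HodgeCM.PerL34 HodgeCM.PerL34.ArchC

variable (U : Universe)

/-- **COR-CM from the leaves**: `COR_CM_theta''` with `A : T.Inputs` replaced by the leaves (`inputs_of_leaves'`). -/
theorem COR_CM_of_leaves' (M : U.ModelAxioms) (T : U.ThetaModel)
    (h07 : N07_hodgeRiemann20 U) (h09a : N09a_embCover T) (h09b : N09b_innerEmb T)
    (h12a : N12a_thetaSub T) (h12b : N12b_signRecipe T)
    (hgen : ∀ {L : CMField} {ι₁ : L →+* ℂ} (V : HermSpace3 L ι₁) (c : SeesawCtx L), T.GoodCtx ι₁ c →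
      N19w_genIdentity T V c (T.t12 V c) 0 1)
    (hcore : ∀ {L : CMField} {ι₁ : L →+* ℂ} (V : HermSpace3 L ι₁) (c : SeesawCtx L), T.GoodCtx ι₁ c →
      N19g_core T V c (T.t34 V c) 2 3)
    (Pc : ∀ {L : CMField} {ι₁ : L →+* ℂ} (V : HermSpace3 L ι₁) (c : SeesawCtx L),
      C4a.PointedCore (T.core V c))
    (A12 : ∀ {L : CMField} {ι₁ : L →+* ℂ} (V : HermSpace3 L ι₁) (c : SeesawCtx L),
      T.GoodCtx ι₁ c → Nonempty (ArchCDatum (T.core V c) (T.t12 V c) (Pc V c)))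
    (A34 : ∀ {L : CMField} {ι₁ : L →+* ℂ} (V : HermSpace3 L ι₁) (c : SeesawCtx L),
      T.GoodCtx ι₁ c → Nonempty (ArchCDatum (T.core V c) (T.t34 V c) (Pc V c)))
    (h31 : ClusterOutputs T) (h33 : WedgeToClasses.StepsPrintInput T)
    (hP : U.PohlmannSpan) (hQ : U.Qw8Sufficiency) : U.HC_CM :=
  COR_CM_theta'' U M T (inputs_of_leaves' T h09a h09b h12a h12b hgen hcore Pc A12 A34 h31 h33) h07 hP hQ

/-- **COR-CM, END STATE from the leaves**: `COR_CM_endState` with its binder `A : T.Inputs` replaced by the leaves.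
Remaining hypotheses: `M`, M29/M30, the three [QW8]-side inputs, PRINT `h07 h09a h09b`, DESIGN `h12b`,
`h12a = T.Open_thetaSub` (S6), model-level `hgen`/`hcore` (S5), `Pc A12 A34` (S4), `h31` (S3), `h33` (S1/S2). -/
theorem COR_CM_endState_of_leaves' (M : U.ModelAxioms) (h29 : U.Fact_weightSpan) (h30 : U.Fact_weightHodge)
    (hE : U.Qw8ExtProd) (hD : U.Qw8DualPushPull) (hMi : U.Qw8Milne) (T : U.ThetaModel)
    (h07 : N07_hodgeRiemann20 U) (h09a : N09a_embCover T) (h09b : N09b_innerEmb T)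
    (h12a : N12a_thetaSub T) (h12b : N12b_signRecipe T)
    (hgen : ∀ {L : CMField} {ι₁ : L →+* ℂ} (V : HermSpace3 L ι₁) (c : SeesawCtx L), T.GoodCtx ι₁ c →
      N19w_genIdentity T V c (T.t12 V c) 0 1)
    (hcore : ∀ {L : CMField} {ι₁ : L →+* ℂ} (V : HermSpace3 L ι₁) (c : SeesawCtx L), T.GoodCtx ι₁ c →
      N19g_core T V c (T.t34 V c) 2 3)
    (Pc : ∀ {L : CMField} {ι₁ : L →+* ℂ} (V : HermSpace3 L ι₁) (c : SeesawCtx L),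
      C4a.PointedCore (T.core V c))
    (A12 : ∀ {L : CMField} {ι₁ : L →+* ℂ} (V : HermSpace3 L ι₁) (c : SeesawCtx L),
      T.GoodCtx ι₁ c → Nonempty (ArchCDatum (T.core V c) (T.t12 V c) (Pc V c)))
    (A34 : ∀ {L : CMField} {ι₁ : L →+* ℂ} (V : HermSpace3 L ι₁) (c : SeesawCtx L),
      T.GoodCtx ι₁ c → Nonempty (ArchCDatum (T.core V c) (T.t34 V c) (Pc V c)))
    (h31 : ClusterOutputs T) (h33 : WedgeToClasses.StepsPrintInput T) : U.HC_CM :=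
  COR_CM_endState U M h29 h30 hE hD hMi T (inputs_of_leaves' T h09a h09b h12a h12b hgen hcore Pc A12 A34 h31 h33) h07

end Assembly
end HodgeCM

end
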